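import Summits.BirchSwinnertonDyer.Rank1Residual.P2.Conjectures.CongruentNumberEvenMonskyLawAtTwo
import HarnessLib

/-!
# Sub-lane «bsd-p2»: THE `k = 5` RUNG OF THE TYPED EVEN LAW C-P2-2, UNFOLDED BY NAME — the exact kernel
# sentence a PR-P2-8 (a) charter («even `ℓ = 5` rung») would predict on: `ord₂ x = 8`, `∏c = 2¹²`,
# `#Ш_an = x/256`, halving bits `b₃ ∧ ¬ b₄` under the displayed `T_even` (bookkeeping; 0 def, 0 facts,
# 0 (K); p2-typer GEN 26 bytes LANDED p374366, module docstring refreshed on T-195, Lean terms unchanged;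
# NO `ℓ = 5` integer is touched or predicted here)

LANDED FILE `Summits/BirchSwinnertonDyer/Rank1Residual/P2/Conjectures/CongruentNumberEvenMonskyLawAtTwoRungFive.lean`
(twin of the landed RungTwo p365071): p2-typer GEN 26 scratch @82138135c913a104 (wakeless seat), LANDED as p374366
(commit 127c3bcb474e; proposed by p2-typer GEN 64) on p2-lead GEN 12's WAKE-T-167 G1 after PR-P2-8's registration;
this module docstring refreshed (text only, in two places: this provenance and the evidence ledger below) by
p2-typer GEN 66 on p2-lead GEN 18's T-195 (`HOME/b2b-bsdres-p2-typer/WAKE-T-167-ADDENDUM-4.md`) with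
`p2/typer/cn/refresh_docstring_t195.py`, Lean terms unchanged (term-diff 0 against @82138135c913a104; T-193 precedent).
p2-lead GEN 9's SWEEP 2026-08-24 predraft lists as candidate next
registration PR-P2-8 (a) «ℓ = 5 even rung (n = 2p₀…p₄ ≡ 6 (8), s = 1, silent; the law predicts
e = ℓ − 2 = 3, m_N = 8, bits (1,1,1,0))», subject to a census-3 FEASIBILITY study. PR-P2-7's charter
derived its `k = 4` prediction row «from landed k-uniform doors BY NAME»; this file does the same for
`k = 5` IN THE KERNEL, from the TYPED law p363094 (`CongruentEvenBSDTwoAt`, `CongruentEvenOrdTwoAt`,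
`congruentEvenBSDTwoAt_iff_halvingBits_of_tEven`) and the landed uniform doors p347324 / p350663, so that
a charter can cite the sentence and its sha instead of prose arithmetic. BLINDNESS RULE respected: no
cell, no numeral of any `ℓ = 5` curve, no engine quantity appears; only `k = 5` is substituted.

HONEST FRAMING (sub-lane «bsd-p2», run/shared/lean/b2b/bsd-rank1-residual/p2/, verbatim in every
file): the target of record is the FULL Birch–Swinnerton-Dyer formula for EVERY analytic-rank `≤ 1`
`E/ℚ` at ALL primes INCLUDING `2`; the odd-prime class ledger is referee A's; the `2`-part is OPEN
(cells O1 = X5 ∖ CM and O12 = the CM corner) and under census by «bsd-p2». Census / instrument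
output at `2` = EVIDENCE / conjecture items with held-out validation, NEVER a Literature fact;
certificates close PAIRS (one isogeny class, `p = 2`), never classes. A conjecture `Prop` is a
SENTENCE. This file asserts NO arithmetic fact: every statement is a definitional unfolding at `k = 5`
or a CONDITIONAL kernel theorem under the displayed binders `hGZK`, `hMe` (Monsky 1994 even), `hT`
(the `T_even` family, PRINTED-ASSERTED, never discharged); the law `CongruentEvenMonskyBSDTwo` is
neither assumed (except in §1's one-line specialisation, whose hypothesis IS the tagged sentence) nor
proved. EVIDENCE LEDGER at `ℓ = 5` (p2-lead GEN 18's words of record, T-195): PR-P2-8 «PT18A» (kit j210436;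
`p2/STRUCTURE-p2.md` v0.24 @5b758666d91793e5 §3 l.38) SCORED INCONCLUSIVE 9/16 (< 13 fully scored: N/A 7 by
guard-digit exhaustion at h ≥ 256 under instrument v1.3; counted neither way; N-P2-10 not fired; bench B4-9) and
PR-P2-9 «PT18B» (kit j220065; §3 l.39; instrument v1.4 = ENGINE-PT18B @bd6cc12db070318a, calibration cal-14 j217763
PASS) SCORED **HIT 16/16** by p2-lead C3-103 (`p2/LEAD-OKS.md` l.683) on sixteen UNSEEN silent cells incl. the seven
PT18A-N/A cells en bloc + LOUD ×4 + anchor (provenance P+G 16/16, single-engine 0, kills none); independent readings: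
bench blind FOLD2 CONCORDANT (HOME/INBOX l.17730), census-lead read-from-raw 42/42 (l.17755), p2-ref GEN 71 R1′ STEP-0
FROM RAW PASS + R2 RESCORE PASS 3/3 + R3 FINAL ×2 (`p2/REFEREE.md` l.556–564), bench B4-10 SIGNED (l.17838) —
«refereed» per p2-lead BATCH 152 (`p2/LEAD-OKS.md` l.688); EVIDENCE only about those pairs from ONE implementation
pair, Ш_an analytic, 0 (K); p2's own count «4-surviving» (PR-P2-5/6/7/9), cell token conj:2-surviving (cell lead
R-12) unchanged; `ℓ ≥ 6` untested.

WHAT IT SAYS AT `k = 5` (tree theorems, `k ↦ 5`): `#E_n(ℚ)_tors = 4`; `∏_ℓ c_ℓ(E_n) = 2^{2·5+2} = 4096`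
(p347324's `tamagawaProduct_congruentNumberCurve_two_mul_prod`); hence for a rank-one datum
`L′(E_n, 1) = x·Ω·Reg`: `#Ш_an = x·16/4096 = x/256` and `BSD(E_n, 2) ⟺ ord₂ x = 2·5 − 2 = 8`; under the
displayed `T_even` (`L′ = 4·Ω·ĥ(s_p)`, `x = 4m²` for `s_p ≡ m·g`): `BSD(E_n, 2) ⟺ v₂(m) = 3 ⟺
s_p ∈ 8E_n(ℚ) + E_n[2] ∧ s_p ∉ 16E_n(ℚ) + E_n[2]` (bits `b₃ ∧ ¬ b₄`; the instrument word «m_N = 8·odd»).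

References: [Monsky1990MockHeegner] Remark (3) (p. 67); [HeathBrown1994SelmerCongruentII] Appendix
(Monsky), typescript p. 41 L20–L36; [TianYuanZhang2017] §1 (1.1), Thm 3.3; [SilvermanAEC2009] VIII.9.3,
X.4.2; [Miller2011LMS] Def 1.1; HOME `p2/lead/SWEEP-2026-08-24-PREDRAFT-GEN4.md` (PR-P2-8 (a));
`p2/lead/PR-P2-7-CHARTER-PREDRAFT-GEN8.md` §0 (the `k = 4` derivation by name).
-/

noncomputable section

open scoped Classical

open WeierstrassCurve Literature.NumberTheory.EllipticCurves
  Literature.NumberTheory.EllipticCurves.Rank1Residual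
  Literature.NumberTheory.EllipticCurves.Rank1Residual.Typed
  Literature.NumberTheory.EllipticCurves.HeathBrown1994
  Literature.NumberTheory.EllipticCurves.TianYuanZhang2017

set_option autoImplicit false

namespace Summit.BirchSwinnertonDyer.Rank1Residual.P2.Conjectures

/-! ## §1 The rung and its sharper sentence at `k = 5`, unfolded (no fact) -/

/-- **The typed law delivers its `k = 5` rung** (one-line specialisation of the tagged sentence; the
hypothesis IS the conjecture — nothing asserted). [cite: Monsky1990MockHeegner, Remark (3) (p. 67)] -/
theorem congruentEvenBSDTwoAt_five_of_congruentEvenMonskyBSDTwo (h : CongruentEvenMonskyBSDTwo) :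
    CongruentEvenBSDTwoAt 5 :=
  h 5 (by norm_num)

/-- **The SHARPER `k = 5` sentence, unfolded: `ord₂ x = 8`.** `CongruentEvenOrdTwoAt 5` says: for all
pairwise distinct primes `p₀, …, p₄` with `n = 2p₀⋯p₄ ≡ 6 (mod 8)` and `s(n) = 1` there is `x ∈ ℚˣ` with
`L′(E_n, 1) = x·Ω(E_n)·Reg(E_n(ℚ))` and `ord₂ x = 8` (`= 2·5 − 2`). Definitional unfolding + `2·5 − 2 = 8`.
[cite: Monsky1990MockHeegner, Remark (3) (p. 67)] [cite: TianYuanZhang2017, §1 (1.1)] -/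
theorem congruentEvenOrdTwoAt_five_iff :
    CongruentEvenOrdTwoAt 5 ↔
      ∀ p : Fin 5 → ℕ, (∀ i, (p i).Prime) → Function.Injective p → (2 * ∏ i, p i) % 8 = 6 →
        monskySelmerRankEven p = 1 →
          ∃ x : ℚ, x ≠ 0 ∧
            deriv (congruentNumberCurve (2 * ∏ i, p i)).entireLFunction 1 =
              (x : ℂ) * ((congruentNumberCurve (2 * ∏ i, p i)).realPeriodRat : ℂ) *
                ((congruentNumberCurve (2 * ∏ i, p i)).regulator : ℂ) ∧
            padicValRat 2 x = 8 := by
  refine forall_congr' fun p => forall_congr' fun _ => forall_congr' fun _ => forall_congr' fun _ =>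
    forall_congr' fun _ => exists_congr fun x => and_congr_right fun _ => and_congr_right fun _ => ?_
  norm_num

/-- **The observable `k = 5` rung ⟺ the `ord₂ x = 8` sentence**, modulo `hGZK`, `hMe` (the law file's §3
at `k = 5`). Asserts neither side. [cite: HeathBrown1994SelmerCongruentII, Appendix (Monsky), typescript p. 41 L20–L36]
[cite: Miller2011LMS, Def. 1.1 (arXiv:1010.2431 p. 3)] -/
theorem congruentEvenBSDTwoAt_five_iff_ordTwo_eight
    (hGZK : rank_eq_analyticRank_of_analyticRank_le_one) (hMe : monsky_card_selmerGroup_two_even) :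
    CongruentEvenBSDTwoAt 5 ↔
      ∀ p : Fin 5 → ℕ, (∀ i, (p i).Prime) → Function.Injective p → (2 * ∏ i, p i) % 8 = 6 →
        monskySelmerRankEven p = 1 →
          ∃ x : ℚ, x ≠ 0 ∧
            deriv (congruentNumberCurve (2 * ∏ i, p i)).entireLFunction 1 =
              (x : ℂ) * ((congruentNumberCurve (2 * ∏ i, p i)).realPeriodRat : ℂ) *
                ((congruentNumberCurve (2 * ∏ i, p i)).regulator : ℂ) ∧
            padicValRat 2 x = 8 :=
  (congruentEvenBSDTwoAt_iff_ordTwoAt hGZK hMe).trans congruentEvenOrdTwoAt_five_iff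

/-! ## §2 Per cell at `k = 5`: `∏c = 4096`, and `BSD(E_n, 2) ⟺ ord₂ x = 8` for ANY rank-one datum -/

/-- **Tamagawa product `2¹² = 4096` on every `k = 5` even cell** (p347324 / lit-1's uniform theorem at
`k = 5`; selection side only). [cite: SilvermanATAEC1994, IV.9.4, Table 4.1] -/
theorem tamagawaProduct_congruentNumberCurve_two_mul_prod_five (p : Fin 5 → ℕ)
    (hp : ∀ i, (p i).Prime) (hinj : Function.Injective p) (h8 : (2 * ∏ i, p i) % 8 = 6) :
    (congruentNumberCurve (2 * ∏ i, p i)).tamagawaProduct = 4096 := by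
  rw [tamagawaProduct_congruentNumberCurve_two_mul_prod p hp (odd_of_two_mul_prod_mod_eight_six p rfl h8)
    hinj rfl]
  norm_num

/-- **THE UNIFORM DOOR AT `k = 5` (p347324, `k ↦ 5`):** for distinct primes with `n = 2p₀⋯p₄ ≡ 6 (mod 8)`,
`s(n) = 1` and ANY rank-one datum `L′(E_n, 1) = x·Ω·Reg`, `x ≠ 0`: `ord_{s=1} L = 1`, rank `1`,
`Ш[2^∞] = 0`, and `BSD(E_n, 2) ⟺ ord₂ x = 8` (`#Ш_an = x·16/4096 = x/256` a `2`-adic unit). Modulo `hGZK`,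
`hMe`; per pair; closes nothing by itself. [cite: HeathBrown1994SelmerCongruentII, Appendix (Monsky), typescript p. 41 L20–L36]
[cite: SilvermanAEC2009, Thm. X.4.2] [cite: Miller2011LMS, Def. 1.1 (arXiv:1010.2431 p. 3)] -/
theorem rankOne_sha_bsdp_two_iff_congruentNumberCurve_two_mul_prod_five
    (hGZK : rank_eq_analyticRank_of_analyticRank_le_one) (hMe : monsky_card_selmerGroup_two_even)
    (p : Fin 5 → ℕ) (hp : ∀ i, (p i).Prime) (hinj : Function.Injective p) {n : ℕ}
    (hn : 2 * ∏ i, p i = n) (h8 : n % 8 = 6) (hs : monskySelmerRankEven p = 1) {x : ℚ} (hx0 : x ≠ 0)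
    (hx : deriv (congruentNumberCurve n).entireLFunction 1 =
      (x : ℂ) * ((congruentNumberCurve n).realPeriodRat : ℂ) * ((congruentNumberCurve n).regulator : ℂ)) :
    (congruentNumberCurve n).analyticRank = 1 ∧ (congruentNumberCurve n).mordellWeilRank = 1 ∧
      AddCommGroup.primaryComponent (congruentNumberCurve n).sha 2 = ⊥ ∧
      (BSDp (congruentNumberCurve n) 2 ↔ padicValRat 2 x = 8) := by
  have h := rankOne_sha_bsdp_two_iff_congruentNumberCurve_two_mul_prod p hGZK hMe hp hinj hn h8 hs hx0 hx
  norm_num at h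
  exact h

/-! ## §3 The halving-bit face at `k = 5` under the displayed `T_even`: `b₃ ∧ ¬ b₄` -/

/-- **`CongruentEvenBSDTwoAt 5 ⟺ «s_p ∈ 8E_n(ℚ) + E_n[2] ∧ s_p ∉ 16E_n(ℚ) + E_n[2]` on every cell»**, modulo
`hGZK`, `hMe` and the DISPLAYED `T_even` family (`2 • s_p ≠ O`, `L′(E_n, 1) = 4·Ω·ĥ(s_p)` — Monsky 1990
Thm 5.14 ∘ TYZ Thm 3.3, PRINTED-ASSERTED, never discharged): the law file's §5 at `k = 5`
(`2^{5−2} = 8`, `2^{5−1} = 16`). In instrument words: `s_p ≡ m·g` with `v₂(m) = 3` («m_N = 8·odd», bits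
`b₁ b₂ b₃ = 1`, `b₄ = 0`). Bookkeeping; asserts nothing. [cite: Monsky1990MockHeegner, Remark (3) (p. 67)]
[cite: SilvermanAEC2009, Thm. VIII.9.3] [cite: Miller2011LMS, Def. 1.1 (arXiv:1010.2431 p. 3)] -/
theorem congruentEvenBSDTwoAt_five_iff_halvingBits_of_tEven [inst : DecidableEq ℚ]
    (hGZK : rank_eq_analyticRank_of_analyticRank_le_one) (hMe : monsky_card_selmerGroup_two_even)
    (s : (p : Fin 5 → ℕ) → (congruentNumberCurve (2 * ∏ i, p i)).toAffine.Point)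
    (hs2 : ∀ p : Fin 5 → ℕ, (∀ i, (p i).Prime) → Function.Injective p → (2 * ∏ i, p i) % 8 = 6 →
      monskySelmerRankEven p = 1 → (2 : ℕ) • s p ≠ 0)
    (hT : ∀ p : Fin 5 → ℕ, (∀ i, (p i).Prime) → Function.Injective p → (2 * ∏ i, p i) % 8 = 6 →
      monskySelmerRankEven p = 1 →
        deriv (congruentNumberCurve (2 * ∏ i, p i)).entireLFunction 1 =
          (4 : ℂ) * ((congruentNumberCurve (2 * ∏ i, p i)).realPeriodRat : ℂ) *
            ((s p).canonicalHeight : ℂ)) :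
    CongruentEvenBSDTwoAt 5 ↔
      ∀ p : Fin 5 → ℕ, (∀ i, (p i).Prime) → Function.Injective p → (2 * ∏ i, p i) % 8 = 6 →
        monskySelmerRankEven p = 1 →
          (∃ T R : (congruentNumberCurve (2 * ∏ i, p i)).toAffine.Point,
              (2 : ℕ) • T = 0 ∧ s p + T = (8 : ℕ) • R) ∧
            ¬ ∃ T R : (congruentNumberCurve (2 * ∏ i, p i)).toAffine.Point,
              (2 : ℕ) • T = 0 ∧ s p + T = (16 : ℕ) • R := by
  have h := congruentEvenBSDTwoAt_iff_halvingBits_of_tEven hGZK hMe (k := 5) (by norm_num) s hs2 hT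
  simp only [Nat.reduceSub, Nat.reducePow] at h
  exact h

end Summit.BirchSwinnertonDyer.Rank1Residual.P2.Conjectures

end
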